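import Literature.Combinatorics.Optimization.TracialDesigns
import HarnessLib

/-!
# Barrier: two-sided (cut-norm / Grothendieck-type) transfer cannot certify the tracial decay of an exact design

Cell pnp-psdrank, route `ChebyshevTracialDesign` (crux `TracialDecayExp20`): the crux asks that the planted
multilevel weight `W = levelWeight n t C w` of a balanced EXACT extrapolation design
(`Literature.Combinatorics.Optimization.IsExactDesign`, [cite: Rothvoss2017, §2 (PDF p. 6, eq. (2))] for the
level classes `Q_c(t)` and the planted weights, [cite: CoppersmithRivlin1992, Thm. (p. 970)] for the
extrapolation regime) have normalised-trace value `≤ e^{−a·dq n}` on the TIGHT psd rectangles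
`0 ⪯ X_U, Y_M ⪯ I`, `X_U Y_M = 0` whenever `|δ(U) ∩ M| = 1` (`TracialValueLEAt`,
[cite: GriblingDelaatLaurent2019, §5]). Because tight strategies do not see the tight pairs, the value of `W`
equals the value of `W + Λ` for every correction `Λ` supported on the tight pairs, and the TWO-SIDED transfer
technology — Grothendieck's inequality `Σ A(U,M)⟨x_U, y_M⟩ ≤ K_G ‖A‖_{∞→1} ≤ 4 K_G ‖A‖_cut` for vectors of
norm `≤ 1` [cite: AlonNaor2006, §1 (K_G ≤ π/(2 ln(1+√2)) = 1.782…) and Lemma 3.1, eq. (4) (‖A‖_C ≤ ‖A‖_{∞→1} ≤ 4‖A‖_C)], applied to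
`x_U = vec(X_U)/√r`, `y_M = vec(Y_M)/√r` — bounds the value in EVERY dimension `r` by a constant times
`min_Λ ‖W + Λ‖_cut`. This file PROVES (no named fact) that this quantity is never small:

* `two_mul_insideCount_add_cc` — `2·|M ∩ E(U)| + |δ(U) ∩ M| = |U|` for a perfect matching `M` and any
  vertex set `U` (double counting vertex–edge incidences);
* `sum_pin_rectSum` — for EVERY weight `F`, the sum over the edges `e` of `K_n` of `F` over the pinned boxes
  `R_e = {U : |U| = t, e ⊆ U} × {M : e ∈ M}` is the `(t − cc)/2`-moment `Σ_{|U| = t} Σ_M F(U,M)·(t − cc(U,M))/2`;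
* `sum_layer_levelWeight_mul` — level sums of the planted weight: `Σ_{|U|=t} Σ_M W(U,M) g(cc(U,M)) = Σ_c w_c g(c)`;
* `exists_rectangle_of_exactDesign` — THE COMPUTATION: for every exact design of degree `D ≥ 1` and every
  tight-supported `Λ` there is a 0/1 rectangle `A × B` with `|Σ_{A × B} (W + Λ)| ≥ 1/(2n(n−1))`. (Exactness on
  `p ≡ 1` gives `W(layer × all) = −1`, exactness on `p = t − x` gives `Σ_e W(R_e) = −t/2`, tightness gives
  `Σ_e Λ(R_e) = λ(t−1)/2` with `λ = Λ(layer × all)`; the `C(n,2)` pinned boxes and the full layer box cannot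
  all be `< 1/(2n(n−1))` in absolute value.)
* `IsTwoSidedTransferCertificate K γ W` — the TECHNIQUE CLASS as a Lean definition: a tight-supported `Λ` and
  a cut-norm bound `κ` on `W + Λ` with `K·κ ≤ γ` — and the BARRIER
  `twoSidedTransferCertificate_ge`: such a certificate for an exact design has `γ ≥ K/(2n(n−1))`.

technique_class: two-sided norm transfer from dimension 1 — any argument bounding the dimension-`r` tracial
  value of a weight `W'` by `K(r)·‖W'‖_cut` (equivalently, up to the factor 4, by `K(r)·‖W'‖_{∞→1}`) applied to
  a tight-corrected weight `W' = W + Λ`, `Λ` supported on the tight pairs: Grothendieck's inequality (`K`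
  dimension-free) [cite: AlonNaor2006, §1 and Lemma 3.1 (eq. (4))], Tsirelson-type bounds for XOR/Bell functionals,
  operator-space transfer with `K(r) = O(r)`; formalised as `IsTwoSidedTransferCertificate K γ W`.
blocks: a proof of the crux `TracialDecayExp20` / `TracialDecayDimBal` of
  `Literature.Combinatorics.Optimization.TracialDesigns` (value `≤ e^{−a·dq n}` resp. `n^{−a·dq n}`) by such a
  certificate: for an exact design of degree `≥ 1` on the `t`-cuts of `K_n` every certificate of the class has
  `γ ≥ K/(2n(n−1))` (`twoSidedTransferCertificate_ge`) — polynomially far from the target for every transfer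
  constant bounded below, `K(r) ≥ K₀ > 0` (all technologies named above have `K = Ω(1)`; Grothendieck's is
  dimension-free), see `not_twoSidedTransferCertificate_exp`. For a hypothetical transfer whose constant DECAYS
  in `r`, the floor `K(r)/(2n(n−1))` is informative only while `K(r) ≫ n² e^{−a·dq n}`, i.e. not for
  `K(r) = r^{−C}` at the crux's ceiling `r ≈ e^{a·dq n/2}` with `C ≥ 2` (referee g40, E-g40-1; the theorems below
  are exact, this clause is prose). [cite: Rothvoss2017, §2 (PDF p. 6, eq. (2))]
because: the designs are ONE-SIDED objects — `W(R) ≤ γ` is asked only on tight-FREE rectangles, while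
  `W(layer × all) = Σ_c w_c = −1` (exactness at `p ≡ 1`) and the average of `W + Λ` over the `C(n,2)` pinned
  boxes `R_e` is `(λ(t−1) − t)/(n(n−1))` (exactness at `p = t − x`: `Σ_c w_c (t − c) = −t`; the pinned-box
  moment identity `Σ_e F(R_e) = Σ F·(t − cc)/2`), so `max(|λ − 1|, |(λ−1)(t−1) − 1|/(n(n−1))) ≥ 1/(2n(n−1))`
  for every `λ`. [cite: Rothvoss2017, §2 (PDF p. 6, eq. (2))] [cite: CoppersmithRivlin1992, Thm. (p. 970)]
evasions_known: ONE-SIDED arguments, which use `tr(X_U Y_M) ≥ 0` (psd-ness) and not only `‖x_U‖, ‖y_M‖ ≤ 1`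
  and tightness: the `r = 1` rectangle lemma itself (Rothvoß's Lemma 6/7: only rectangles AVOIDING `Q_1` are
  bounded) [cite: Rothvoss2017, Lemma 6 and Lemma 7 (PDF pp. 6–8)], and the cell's landed special cases
  (commutative / block-diagonal / finitely-valued strategies: layer-cake decompositions into tight-free
  rectangles). None is known to reach general dimension `r`.
scope_caveats: the barrier bounds what a certificate OF THIS SHAPE can certify; it does not say the crux is
  false, and it does not cover arguments mixing the cut norm with one-sided information. The soundness of the
  class for psd rectangles of dimension `r` (Grothendieck's inequality via `vec`) is quoted, not proved here —
  only the trivial `r = 1` soundness `rectSum_le_of_cutNormLE` is. The constant `1/(2n(n−1))` is not claimed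
  to be sharp (the pinned box suggests `≈ 1/(n(n−1))`). Hypotheses: `IsExactDesign` with `D ≥ 1` (the crux uses
  `D = dq n ≥ 1`); balancedness is not needed. [cite: AlonNaor2006, §1 and Lemma 3.1 (eq. (4))]
status: established (elementary double counting; this file is the proof).
-/

noncomputable section

open Finset

namespace Literature.Barriers.PneNP

open Literature.Combinatorics.Optimization (levelWeight IsExactDesign)
open Literature.Combinatorics.SimpleGraph.CycleSpace (Crosses crosses_mk)

variable {n : ℕ}

/-! ### §1 Inside edges of a cut: `2·|M ∩ E(U)| + |δ(U) ∩ M| = |U|` -/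

/-- The number of edges of `M` with both endpoints in `U` (`|M ∩ E(U)|`). [cite: Rothvoss2017, §2 (PDF p. 5)] -/
def insideCount (U : Finset (Fin n)) (M : Finset (Sym2 (Fin n))) : ℕ :=
  (M.filter fun e => ∀ v ∈ e, v ∈ U).card

/-- Incidences of a non-loop pair with a vertex set: `|{x,y} ∩ U| = 2·1[x,y ∈ U] + 1[{x,y} crosses U]`.
[folklore] -/
private theorem card_filter_mem_mk (U : Finset (Fin n)) {x y : Fin n} (hxy : x ≠ y) :
    ((U.filter fun v => v ∈ s(x, y)).card : ℕ) =
      2 * (if (x ∈ U ∧ y ∈ U) then 1 else 0) + (if Crosses U s(x, y) then 1 else 0) := by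
  classical
  have hset : (U.filter fun v => v ∈ s(x, y)) = ({x, y} : Finset (Fin n)).filter (fun v => v ∈ U) := by
    ext v
    simp only [mem_filter, Sym2.mem_iff, mem_insert, mem_singleton]
    tauto
  rw [hset, filter_insert, filter_singleton]
  by_cases hx : x ∈ U <;> by_cases hy : y ∈ U <;> simp [hx, hy, crosses_mk, hxy]

/-- **Double counting**: `2·|M ∩ E(U)| + |δ(U) ∩ M| = |U|` for a perfect matching `M` of `K_n` and any vertex
set `U` (every vertex of `U` lies on exactly one edge of `M`; an edge meets `U` in `2`, `1` or `0` vertices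
according as it is inside, crossing or outside). [cite: Rothvoss2017, §2 (PDF p. 5)] -/
theorem two_mul_insideCount_add_cc (U : OddSet n) (M : PMatch n) :
    2 * insideCount U.1 M.1 + cc U M = U.1.card := by
  classical
  have hM := M.2
  have h1 : U.1.card = ∑ v ∈ U.1, (M.1.filter fun e => v ∈ e).card := by
    rw [card_eq_sum_ones]
    exact sum_congr rfl fun v _ => (hM.card_filter (mem_univ v)).symm
  have h2 : ∑ v ∈ U.1, (M.1.filter fun e => v ∈ e).card = ∑ e ∈ M.1, (U.1.filter fun v => v ∈ e).card := by
    simp only [card_eq_sum_ones, sum_filter]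
    exact sum_comm
  have h3 : ∀ e ∈ M.1, (U.1.filter fun v => v ∈ e).card =
      2 * (if (∀ v ∈ e, v ∈ U.1) then 1 else 0) + (if Crosses U.1 e then 1 else 0) := by
    intro e he
    have hnd : ¬e.IsDiag := hM.not_isDiag he
    induction e using Sym2.ind with
    | h x y =>
      have hxy : x ≠ y := fun h => hnd (Sym2.mk_isDiag_iff.2 h)
      rw [card_filter_mem_mk U.1 hxy]
      congr 2
      simp only [Sym2.ball]
  have key : U.1.card = ∑ e ∈ M.1,
      (2 * (if (∀ v ∈ e, v ∈ U.1) then 1 else 0) + (if Crosses U.1 e then 1 else 0)) :=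
    h1.trans (h2.trans (sum_congr rfl h3))
  rw [key, sum_add_distrib, ← mul_sum]
  unfold insideCount cc
  rw [card_filter, card_filter]

/-- On the `t`-layer: `|M ∩ E(U)| = (t − |δ(U) ∩ M|)/2` (as a real number). [cite: Rothvoss2017, §2 (PDF p. 5)] -/
theorem insideCount_eq_of_card_eq {t : ℕ} (U : OddSet n) (M : PMatch n) (hU : U.1.card = t) :
    (insideCount U.1 M.1 : ℝ) = ((t : ℝ) - cc U M) / 2 := by
  have h := two_mul_insideCount_add_cc U M
  rw [hU] at h
  have h' : (2 : ℝ) * (insideCount U.1 M.1 : ℝ) + (cc U M : ℝ) = t := by exact_mod_cast h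
  linarith

/-! ### §2 Rectangles, the `t`-layer, and the pinned boxes `R_e` -/

/-- The sum of a weight over the 0/1 rectangle `A × B` (`⟨F, 1_{A × B}⟩`). [cite: Rothvoss2017, §2 (PDF p. 6)] -/
def rectSum (F : OddSet n → PMatch n → ℝ) (A : Finset (OddSet n)) (B : Finset (PMatch n)) : ℝ :=
  ∑ U ∈ A, ∑ M ∈ B, F U M

variable (n) in
/-- The `t`-layer of odd cuts `{U : |U| = t}`. [cite: Rothvoss2017, §2 (PDF p. 6)] -/
def layerCuts (t : ℕ) : Finset (OddSet n) := univ.filter fun U => U.1.card = t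

variable (n) in
/-- Cut side of the pinned box of the pair `e`: the `t`-cuts containing both points of `e`.
[cite: Rothvoss2017, §2 (PDF p. 6)] -/
def pinCuts (t : ℕ) (e : Sym2 (Fin n)) : Finset (OddSet n) :=
  univ.filter fun U => U.1.card = t ∧ ∀ v ∈ e, v ∈ U.1

variable (n) in
/-- Matching side of the pinned box of the pair `e`: the perfect matchings containing `e`.
[cite: Rothvoss2017, §2 (PDF p. 6)] -/
def pinMatchings (e : Sym2 (Fin n)) : Finset (PMatch n) := univ.filter fun M => e ∈ M.1

/-- A loop is an edge of no perfect matching: its pinned box is empty. [folklore] -/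
private theorem pinMatchings_eq_empty_of_isDiag {e : Sym2 (Fin n)} (he : e.IsDiag) : pinMatchings n e = ∅ :=
  filter_eq_empty_iff.2 fun M _ hM => M.2.not_isDiag hM he

/-- The rectangle sum over an empty matching side vanishes. [folklore] -/
private theorem rectSum_empty_right (F : OddSet n → PMatch n → ℝ) (A : Finset (OddSet n)) : rectSum F A ∅ = 0 := by
  simp [rectSum]

/-- **The pinned-box moment identity.** For every weight `F` on cuts × matchings, summing `F` over the pinned
boxes `R_e = {U : |U| = t, e ⊆ U} × {M : e ∈ M}` of all pairs `e` counts each `(U, M)` of the `t`-layer once per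
edge of `M` inside `U`: `Σ_e F(R_e) = Σ_{|U| = t} Σ_M F(U,M)·|M ∩ E(U)|`. [cite: Rothvoss2017, §2 (PDF p. 6)] -/
theorem sum_pin_rectSum (t : ℕ) (F : OddSet n → PMatch n → ℝ) :
    ∑ e : Sym2 (Fin n), rectSum F (pinCuts n t e) (pinMatchings n e) =
      ∑ U ∈ layerCuts n t, ∑ M, F U M * (insideCount U.1 M.1 : ℝ) := by
  classical
  have hL : ∀ e : Sym2 (Fin n), rectSum F (pinCuts n t e) (pinMatchings n e) =
      ∑ U : OddSet n, ∑ M : PMatch n,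
        (if (U.1.card = t ∧ ∀ v ∈ e, v ∈ U.1) then (if e ∈ M.1 then F U M else 0) else 0) := by
    intro e
    rw [rectSum, pinCuts, sum_filter]
    refine sum_congr rfl fun U _ => ?_
    split_ifs
    · rw [pinMatchings, sum_filter]
    · simp
  have hR : ∀ U : OddSet n, ∀ M : PMatch n, F U M * (insideCount U.1 M.1 : ℝ) =
      ∑ e : Sym2 (Fin n), (if (∀ v ∈ e, v ∈ U.1) then (if e ∈ M.1 then F U M else 0) else 0) := by
    intro U M
    rw [insideCount, card_filter, Nat.cast_sum, mul_sum]
    rw [← sum_subset (subset_univ M.1) (fun e _ he => by simp [he])]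
    refine sum_congr rfl fun e he => ?_
    by_cases h1 : ∀ v ∈ e, v ∈ U.1 <;> simp [h1, he]
  simp_rw [hL]
  rw [sum_comm]
  rw [layerCuts, sum_filter]
  refine sum_congr rfl fun U _ => ?_
  by_cases hU : U.1.card = t
  · simp only [hU, true_and, if_true]
    rw [sum_comm]
    exact sum_congr rfl fun M _ => (hR U M).symm
  · simp [hU]

/-- The pinned-box identity on the `t`-layer in closed form: `Σ_e F(R_e) = Σ_{|U| = t} Σ_M F(U,M)·(t − cc(U,M))/2`.
[cite: Rothvoss2017, §2 (PDF p. 6)] -/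
theorem sum_pin_rectSum_eq_moment (t : ℕ) (F : OddSet n → PMatch n → ℝ) :
    ∑ e : Sym2 (Fin n), rectSum F (pinCuts n t e) (pinMatchings n e) =
      ∑ U ∈ layerCuts n t, ∑ M, F U M * (((t : ℝ) - cc U M) / 2) := by
  rw [sum_pin_rectSum]
  refine sum_congr rfl fun U hU => sum_congr rfl fun M _ => ?_
  rw [insideCount_eq_of_card_eq U M (mem_filter.1 hU).2]

/-- Only the `C(n,2)` non-loop pairs contribute: the sum over all of `Sym2 (Fin n)` equals the sum over the
edges of `K_n`. [folklore] -/
private theorem sum_pin_rectSum_eq_sum_filter (t : ℕ) (F : OddSet n → PMatch n → ℝ) :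
    ∑ e : Sym2 (Fin n), rectSum F (pinCuts n t e) (pinMatchings n e) =
      ∑ e ∈ (univ : Finset (Sym2 (Fin n))).filter (fun e => ¬e.IsDiag),
        rectSum F (pinCuts n t e) (pinMatchings n e) := by
  rw [sum_filter_of_ne]
  intro e _ hne hd
  rw [pinMatchings_eq_empty_of_isDiag hd, rectSum_empty_right] at hne
  exact hne rfl

/-- `|E(K_n)| = C(n,2)` in the `Finset.filter` form. [folklore] -/
private theorem card_filter_not_isDiag (n : ℕ) :
    ((univ : Finset (Sym2 (Fin n))).filter (fun e => ¬e.IsDiag)).card = n.choose 2 := by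
  rw [← Fintype.card_subtype, Sym2.card_subtype_not_diag, Fintype.card_fin]

/-! ### §3 Level sums of the planted weight and of a tight-supported correction -/

/-- **Level sums of the planted weight**: `Σ_{|U| = t} Σ_M W(U,M)·g(cc(U,M)) = Σ_{c ∈ C} w_c g(c)` whenever the
used level classes are nonempty (`W = Σ_c w_c μ_{Q_c(t)}` and `μ_{Q_c(t)}` is a probability measure on which
`cc ≡ c`). [cite: Rothvoss2017, §2 (PDF p. 6, eq. (2))] -/
theorem sum_layer_levelWeight_mul {t : ℕ} {C : Finset ℕ} (w : ℕ → ℝ) (g : ℕ → ℝ)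
    (hne : ∀ c ∈ C, (Qset n t c).Nonempty) :
    ∑ U ∈ layerCuts n t, ∑ M, levelWeight n t C w U M * g (cc U M) = ∑ c ∈ C, w c * g c := by
  classical
  calc ∑ U ∈ layerCuts n t, ∑ M, levelWeight n t C w U M * g (cc U M)
      = ∑ U ∈ layerCuts n t, ∑ M : PMatch n, ∑ c ∈ C,
          (if (U, M) ∈ Qset n t c then w c / ((Qset n t c).card : ℝ) * g c else 0) := by
        refine sum_congr rfl fun U _ => sum_congr rfl fun M _ => ?_
        rw [levelWeight, sum_mul]
        refine sum_congr rfl fun c _ => ?_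
        split_ifs with h
        · rw [(mem_Qset_iff.1 h).2]
        · rw [zero_mul]
    _ = ∑ U : OddSet n, ∑ M : PMatch n, ∑ c ∈ C,
          (if (U, M) ∈ Qset n t c then w c / ((Qset n t c).card : ℝ) * g c else 0) := by
        refine sum_subset (filter_subset _ _) fun U _ hU => ?_
        refine sum_eq_zero fun M _ => sum_eq_zero fun c _ => ?_
        rw [if_neg]
        intro h
        exact hU (mem_filter.2 ⟨mem_univ _, (mem_Qset_iff.1 h).1⟩)
    _ = ∑ U : OddSet n, ∑ c ∈ C, ∑ M : PMatch n,
          (if (U, M) ∈ Qset n t c then w c / ((Qset n t c).card : ℝ) * g c else 0) :=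
        sum_congr rfl fun U _ => sum_comm
    _ = ∑ c ∈ C, ∑ U : OddSet n, ∑ M : PMatch n,
          (if (U, M) ∈ Qset n t c then w c / ((Qset n t c).card : ℝ) * g c else 0) := sum_comm
    _ = ∑ c ∈ C, ((Qset n t c).card : ℝ) * (w c / ((Qset n t c).card : ℝ) * g c) := by
        refine sum_congr rfl fun c _ => ?_
        rw [sum_sum_ite_mem (Qset n t c) (fun _ _ => w c / ((Qset n t c).card : ℝ) * g c), sum_const,
          nsmul_eq_mul]
    _ = ∑ c ∈ C, w c * g c := by
        refine sum_congr rfl fun c hc => ?_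
        have hcard : ((Qset n t c).card : ℝ) ≠ 0 := by
          exact_mod_cast (card_pos.2 (hne c hc)).ne'
        field_simp

/-- The mass of a weight on the `t`-layer, `F(layer × all)`. [cite: Rothvoss2017, §2 (PDF p. 6)] -/
def layerMass (t : ℕ) (F : OddSet n → PMatch n → ℝ) : ℝ := ∑ U ∈ layerCuts n t, ∑ M, F U M

/-- The full layer box is a rectangle: `rectSum F (layer t) univ = layerMass t F`. [folklore] -/
private theorem rectSum_layer_univ (t : ℕ) (F : OddSet n → PMatch n → ℝ) :
    rectSum F (layerCuts n t) univ = layerMass t F := rfl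

/-- A correction supported on the tight pairs has `(t − cc)/2`-moment `λ(t−1)/2`, `λ` its layer mass.
[cite: Rothvoss2017, §2 (PDF p. 6)] -/
theorem sum_layer_tight_mul {t : ℕ} (Λ : OddSet n → PMatch n → ℝ) (hΛ : ∀ U M, Λ U M ≠ 0 → cc U M = 1) :
    ∑ U ∈ layerCuts n t, ∑ M, Λ U M * (((t : ℝ) - cc U M) / 2) = layerMass t Λ * (((t : ℝ) - 1) / 2) := by
  rw [layerMass, sum_mul]
  refine sum_congr rfl fun U _ => ?_
  rw [sum_mul]
  refine sum_congr rfl fun M _ => ?_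
  by_cases h : Λ U M = 0
  · rw [h, zero_mul, zero_mul]
  · rw [hΛ U M h, Nat.cast_one]

/-! ### §4 What exactness gives: `Σ_c w_c = −1` and `Σ_c w_c (t − c) = −t` -/

/-- Exactness at the constant polynomial: `Σ_c w_c = −1`. [cite: CoppersmithRivlin1992, Thm. (p. 970)] -/
theorem exactDesign_sum_w {t T D : ℕ} {B : ℝ} {C : Finset ℕ} {w : ℕ → ℝ}
    (h : IsExactDesign n t T D B C w) : ∑ c ∈ C, w c = -1 := by
  have hx := h.2.2.2.2.2.1 (Polynomial.C 1) (by rw [Polynomial.natDegree_C]; exact Nat.zero_le _)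
  simpa using hx

/-- Exactness at the linear polynomial `t − x` (needs degree `D ≥ 1`): `Σ_c w_c (t − c) = −t`.
[cite: CoppersmithRivlin1992, Thm. (p. 970)] -/
theorem exactDesign_sum_w_mul_sub {t T D : ℕ} {B : ℝ} {C : Finset ℕ} {w : ℕ → ℝ}
    (h : IsExactDesign n t T D B C w) (hD : 1 ≤ D) :
    ∑ c ∈ C, w c * ((t : ℝ) - c) = -(t : ℝ) := by
  have hdeg : (Polynomial.C (t : ℝ) - Polynomial.X).natDegree ≤ D := by
    refine le_trans (Polynomial.natDegree_sub_le _ _) ?_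
    rw [Polynomial.natDegree_C, Polynomial.natDegree_X]
    exact max_le (Nat.zero_le _) hD
  have hx := h.2.2.2.2.2.1 (Polynomial.C (t : ℝ) - Polynomial.X) hdeg
  simpa using hx

/-- An exact design lives on cuts of size `t ≥ 3` inside `K_n` with `n ≥ 8`: some level `3 ≤ c ≤ T ≤ t` is used
(the normalisation `Σ_c w_c (c−1) = 1` forces `C ≠ ∅`) and `2t + 2 ≤ n`. [cite: Rothvoss2017, §2 (PDF p. 6)] -/
theorem exactDesign_three_le {t T D : ℕ} {B : ℝ} {C : Finset ℕ} {w : ℕ → ℝ}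
    (h : IsExactDesign n t T D B C w) : 3 ≤ t ∧ 2 * t + 2 ≤ n := by
  obtain ⟨_, h2t, hT, hC, hnorm, -, -⟩ := h
  have hCne : C.Nonempty := by
    by_contra hC0
    rw [not_nonempty_iff_eq_empty] at hC0
    rw [hC0, sum_empty] at hnorm
    exact zero_ne_one hnorm
  obtain ⟨c, hc⟩ := hCne
  exact ⟨le_trans (hC c hc).2.1 (le_trans (hC c hc).2.2.1 hT), h2t⟩

/-! ### §5 The computation: some rectangle carries `≥ 1/(2n(n−1))` of `W + Λ` -/

/-- **The cut norm of a tight-corrected exact design is at least `1/(2n(n−1))`.** For an exact design of degree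
`D ≥ 1` with planted weight `W` and ANY correction `Λ` supported on the tight pairs `|δ(U) ∩ M| = 1`, some 0/1
rectangle `A × B` has `|Σ_{A × B} (W + Λ)| ≥ 1/(2n(n−1))`: with `λ = Λ(layer × all)`, the layer box carries
`λ − 1` and the `C(n,2)` pinned boxes carry `((λ−1)(t−1) − 1)/2` in total.
[cite: Rothvoss2017, §2 (PDF p. 6, eq. (2))] [cite: CoppersmithRivlin1992, Thm. (p. 970)] -/
theorem exists_rectangle_of_exactDesign {t T D : ℕ} {B : ℝ} {C : Finset ℕ} {w : ℕ → ℝ}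
    (hdes : IsExactDesign n t T D B C w) (hD : 1 ≤ D) (Λ : OddSet n → PMatch n → ℝ)
    (hΛ : ∀ U M, Λ U M ≠ 0 → cc U M = 1) :
    ∃ (A : Finset (OddSet n)) (Bm : Finset (PMatch n)),
      1 / (2 * (n : ℝ) * ((n : ℝ) - 1)) ≤ |rectSum (fun U M => levelWeight n t C w U M + Λ U M) A Bm| := by
  classical
  obtain ⟨ht3, h2t⟩ := exactDesign_three_le hdes
  have hne : ∀ c ∈ C, (Qset n t c).Nonempty := fun c hc => (hdes.2.2.2.1 c hc).2.2.2
  set F : OddSet n → PMatch n → ℝ := fun U M => levelWeight n t C w U M + Λ U M with hF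
  set lam : ℝ := layerMass t Λ with hlam
  -- the layer box carries `λ − 1`
  have hbox : rectSum F (layerCuts n t) univ = lam - 1 := by
    rw [rectSum_layer_univ, layerMass]
    have hW : ∑ U ∈ layerCuts n t, ∑ M, levelWeight n t C w U M = -1 := by
      have h := sum_layer_levelWeight_mul (n := n) (t := t) (C := C) w (fun _ => (1 : ℝ)) hne
      simp only [mul_one] at h
      rw [h, exactDesign_sum_w hdes]
    simp only [hF, sum_add_distrib]
    rw [hW, hlam, layerMass]
    ring
  -- the pinned boxes carry `((λ−1)(t−1) − 1)/2` in total
  have hpins : ∑ e ∈ (univ : Finset (Sym2 (Fin n))).filter (fun e => ¬e.IsDiag),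
      rectSum F (pinCuts n t e) (pinMatchings n e) = ((lam - 1) * ((t : ℝ) - 1) - 1) / 2 := by
    rw [← sum_pin_rectSum_eq_sum_filter, sum_pin_rectSum_eq_moment]
    have hW : ∑ U ∈ layerCuts n t, ∑ M, levelWeight n t C w U M * (((t : ℝ) - cc U M) / 2) = -(t : ℝ) / 2 := by
      have h := sum_layer_levelWeight_mul (n := n) (t := t) (C := C) w (fun c => ((t : ℝ) - c) / 2) hne
      rw [h]
      have h2 : ∑ c ∈ C, w c * (((t : ℝ) - c) / 2) = (∑ c ∈ C, w c * ((t : ℝ) - c)) / 2 := by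
        rw [sum_div]
        exact sum_congr rfl fun c _ => by ring
      rw [h2, exactDesign_sum_w_mul_sub hdes hD]
    have hL := sum_layer_tight_mul (n := n) (t := t) Λ hΛ
    simp only [hF, add_mul, sum_add_distrib]
    rw [hW, hL, hlam]
    ring
  -- positivity bookkeeping
  have hn2 : (2 : ℝ) ≤ n := by exact_mod_cast (by omega : 2 ≤ n)
  have htn : (t : ℝ) - 1 ≤ (n : ℝ) * ((n : ℝ) - 1) := by
    have : (t : ℝ) ≤ n := by exact_mod_cast (by omega : t ≤ n)
    nlinarith
  have ht1 : (1 : ℝ) ≤ (t : ℝ) - 1 := by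
    have : (3 : ℝ) ≤ t := by exact_mod_cast ht3
    linarith
  have hpos : (0 : ℝ) < 2 * (n : ℝ) * ((n : ℝ) - 1) := by nlinarith
  have hn0 : (n : ℝ) ≠ 0 := by positivity
  have hn1 : (n : ℝ) - 1 ≠ 0 := by
    have : (0 : ℝ) < (n : ℝ) - 1 := by linarith
    exact this.ne'
  set δ : ℝ := 1 / (2 * (n : ℝ) * ((n : ℝ) - 1)) with hδ
  have hδpos : 0 < δ := by rw [hδ]; positivity
  by_contra hcon
  push Not at hcon
  -- every rectangle is `< δ` in absolute value
  have h0 : |lam - 1| < δ := by rw [← hbox]; exact hcon _ _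
  have h1 : |((lam - 1) * ((t : ℝ) - 1) - 1) / 2| ≤ (n.choose 2 : ℝ) * δ := by
    rw [← hpins]
    refine le_trans (abs_sum_le_sum_abs _ _) ?_
    refine le_trans (sum_le_sum fun e _ => (hcon (pinCuts n t e) (pinMatchings n e)).le) ?_
    rw [sum_const, nsmul_eq_mul, card_filter_not_isDiag]
  rw [Nat.cast_choose_two] at h1
  have hquarter : (n : ℝ) * ((n : ℝ) - 1) / 2 * δ = 1 / 4 := by
    rw [hδ]
    field_simp
    ring
  rw [hquarter] at h1
  -- `|(λ−1)(t−1) − 1| ≤ 1/2` and `|(λ−1)(t−1)| < 1/2`: impossible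
  have h2 : |(lam - 1) * ((t : ℝ) - 1) - 1| ≤ 1 / 2 := by
    rw [abs_div, abs_two] at h1
    linarith
  have h3 : |(lam - 1) * ((t : ℝ) - 1)| < 1 / 2 := by
    rw [abs_mul, abs_of_pos (by linarith : (0 : ℝ) < (t : ℝ) - 1)]
    calc |lam - 1| * ((t : ℝ) - 1) < δ * ((t : ℝ) - 1) := by
          exact mul_lt_mul_of_pos_right h0 (by linarith)
      _ ≤ δ * ((n : ℝ) * ((n : ℝ) - 1)) := by exact mul_le_mul_of_nonneg_left htn hδpos.le
      _ = 1 / 2 := by rw [hδ]; field_simp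
  have h4 : (1 : ℝ) ≤ |(lam - 1) * ((t : ℝ) - 1)| + |(lam - 1) * ((t : ℝ) - 1) - 1| := by
    have := abs_sub_le ((lam - 1) * ((t : ℝ) - 1)) 0 ((lam - 1) * ((t : ℝ) - 1) - 1)
    have e1 : |(lam - 1) * ((t : ℝ) - 1) - ((lam - 1) * ((t : ℝ) - 1) - 1)| = 1 := by
      rw [show (lam - 1) * ((t : ℝ) - 1) - ((lam - 1) * ((t : ℝ) - 1) - 1) = 1 by ring, abs_one]
    have e2 : |(0 : ℝ) - ((lam - 1) * ((t : ℝ) - 1) - 1)| = |(lam - 1) * ((t : ℝ) - 1) - 1| := by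
      rw [zero_sub, abs_neg]
    rw [sub_zero] at this
    linarith [e1, e2, abs_sub_abs_le_abs_sub ((lam - 1) * ((t : ℝ) - 1)) ((lam - 1) * ((t : ℝ) - 1) - 1)]
  linarith

/-! ### §6 The technique class and the barrier -/

/-- `CutNormLE F κ`: every 0/1 rectangle sum of `F` is at most `κ` in absolute value (`‖F‖_cut ≤ κ`).
[cite: AlonNaor2006, §1 (the cut norm ‖A‖_C) and Lemma 3.1] -/
def CutNormLE (F : OddSet n → PMatch n → ℝ) (κ : ℝ) : Prop :=
  ∀ (A : Finset (OddSet n)) (B : Finset (PMatch n)), |rectSum F A B| ≤ κ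

/-- **The technique class: two-sided transfer certificates.** `γ` is certified as an upper bound for the (tight,
psd, any-dimension) value of the weight `W` by a two-sided transfer with constant `K` iff there are a
correction `Λ` supported on the tight pairs `|δ(U) ∩ M| = 1` (invisible to tight strategies) and a cut-norm
bound `‖W + Λ‖_cut ≤ κ` with `K·κ ≤ γ`. SOUNDNESS of such certificates in every dimension `r` — with
`K = 4·K_G`, `K_G ≤ π/(2 ln(1+√2)) < 1.783`, for the value `Σ (W+Λ)(U,M)⟨x_U, y_M⟩` at vectors
`x_U = vec(X_U)/√r`, `y_M = vec(Y_M)/√r` of norm `≤ 1` — is Grothendieck's inequality together with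
`‖A‖_{∞→1} ≤ 4‖A‖_C`; it is quoted, not used below. [cite: AlonNaor2006, §1 and Lemma 3.1 (eq. (4))] -/
def IsTwoSidedTransferCertificate (K γ : ℝ) (W : OddSet n → PMatch n → ℝ) : Prop :=
  ∃ (Λ : OddSet n → PMatch n → ℝ) (κ : ℝ), (∀ U M, Λ U M ≠ 0 → cc U M = 1) ∧
    CutNormLE (fun U M => W U M + Λ U M) κ ∧ K * κ ≤ γ

/-- Soundness in dimension `1` (the only soundness proved here): a cut-norm bound on a tight-corrected weight
bounds the ORIGINAL weight on every rectangle avoiding the tight pairs — the hypothesis of Rothvoß's rectangle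
lemma / of `RectangleDecayBal`. [cite: Rothvoss2017, Lemma 6 (PDF p. 6)] -/
theorem rectSum_le_of_cutNormLE {W Λ : OddSet n → PMatch n → ℝ} {κ : ℝ}
    (hΛ : ∀ U M, Λ U M ≠ 0 → cc U M = 1) (hcut : CutNormLE (fun U M => W U M + Λ U M) κ)
    {A : Finset (OddSet n)} {B : Finset (PMatch n)} (hfree : ∀ U ∈ A, ∀ M ∈ B, cc U M ≠ 1) :
    rectSum W A B ≤ κ := by
  have heq : rectSum W A B = rectSum (fun U M => W U M + Λ U M) A B := by
    unfold rectSum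
    refine sum_congr rfl fun U hU => sum_congr rfl fun M hM => ?_
    have : Λ U M = 0 := by
      by_contra h
      exact hfree U hU M hM (hΛ U M h)
    show W U M = W U M + Λ U M
    rw [this, add_zero]
  rw [heq]
  exact le_trans (le_abs_self _) (hcut A B)

/-- **BARRIER.** For the planted weight of an exact extrapolation design of degree `D ≥ 1` on the `t`-cuts of
`K_n`, every two-sided transfer certificate with constant `K ≥ 0` certifies only `γ ≥ K/(2n(n−1))`: no
inequality of the shape «value ≤ K(r)·‖W + Λ‖_cut» (Grothendieck / Tsirelson / operator-space transfer from
`r = 1`) can prove a bound below `K(r)/(2n(n−1))`, in particular not the crux's `e^{−a·dq n}`.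
[cite: AlonNaor2006, §1 and Lemma 3.1 (eq. (4))] [cite: Rothvoss2017, §2 (PDF p. 6, eq. (2))] -/
theorem twoSidedTransferCertificate_ge {t T D : ℕ} {B : ℝ} {C : Finset ℕ} {w : ℕ → ℝ}
    (hdes : IsExactDesign n t T D B C w) (hD : 1 ≤ D) {K γ : ℝ} (hK : 0 ≤ K)
    (hcert : IsTwoSidedTransferCertificate K γ (levelWeight n t C w)) :
    K / (2 * (n : ℝ) * ((n : ℝ) - 1)) ≤ γ := by
  obtain ⟨Λ, κ, hΛ, hcut, hKκ⟩ := hcert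
  obtain ⟨A, Bm, hAB⟩ := exists_rectangle_of_exactDesign hdes hD Λ hΛ
  have hκ : 1 / (2 * (n : ℝ) * ((n : ℝ) - 1)) ≤ κ := le_trans hAB (hcut A Bm)
  calc K / (2 * (n : ℝ) * ((n : ℝ) - 1)) = K * (1 / (2 * (n : ℝ) * ((n : ℝ) - 1))) := by ring
    _ ≤ K * κ := mul_le_mul_of_nonneg_left hκ hK
    _ ≤ γ := hKκ

/-- Monotonicity of the class in the certified bound. [cite: AlonNaor2006, §1 and Lemma 3.1 (eq. (4))] -/
theorem IsTwoSidedTransferCertificate.mono {K γ γ' : ℝ} {W : OddSet n → PMatch n → ℝ}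
    (h : IsTwoSidedTransferCertificate K γ W) (hle : γ ≤ γ') : IsTwoSidedTransferCertificate K γ' W := by
  obtain ⟨Λ, κ, hΛ, hcut, hK⟩ := h
  exact ⟨Λ, κ, hΛ, hcut, le_trans hK hle⟩

/-! ### §7 At the crux's scale: `e^{−a·dq n} < K/(2n(n−1))` for all large `n` -/

open Literature.Combinatorics.Optimization (dq)

/-- `n < (dq n + 1)⁴` (`dq n = ⌊⌊√n⌋^{1/2}⌋`). (The summit tree has the same statement as
`Summit.PneNP.PneNP.Theorems.ChebyshevTracialDesignAssembly.lt_dq_succ_pow_four`; Literature files cannot import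
`Summits.*`, so it is re-proved here in three lines.) [cite: CoppersmithRivlin1992, Thm. (p. 970)] -/
theorem lt_dq_add_one_pow_four (n : ℕ) : n < (dq n + 1) ^ 4 := by
  have h1 : n < (Nat.sqrt n + 1) ^ 2 := Nat.lt_succ_sqrt' n
  have h2 : Nat.sqrt n + 1 ≤ (dq n + 1) ^ 2 := Nat.succ_le_of_lt (Nat.lt_succ_sqrt' (Nat.sqrt n))
  calc n < (Nat.sqrt n + 1) ^ 2 := h1
    _ ≤ ((dq n + 1) ^ 2) ^ 2 := Nat.pow_le_pow_left h2 2
    _ = (dq n + 1) ^ 4 := by ring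

/-- `d ≤ dq n` as soon as `d⁴ ≤ n`. (Summit-side twin:
`Summit.PneNP.PneNP.Theorems.ChebyshevTracialDesignBoundedDim.le_dq_of_pow_le`, not importable here.)
[cite: CoppersmithRivlin1992, Thm. (p. 970)] -/
theorem le_dq_of_pow_four_le {d n : ℕ} (h : d ^ 4 ≤ n) : d ≤ dq n := by
  unfold dq
  rw [Nat.le_sqrt', Nat.le_sqrt']
  calc (d ^ 2) ^ 2 = d ^ 4 := by ring
    _ ≤ n := h

/-- **The crux's scale is below the barrier, eventually**: for `K, a > 0` and all large `n`,
`e^{−a·dq n} < K/(2n(n−1))` (since `dq n ≍ n^{1/4}` and `e^{a d} ≥ (a d)⁹/9!`). [cite: CoppersmithRivlin1992, Thm. (p. 970)] -/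
theorem exp_neg_dq_lt_eventually {K a : ℝ} (hK : 0 < K) (ha : 0 < a) :
    ∃ n₀ : ℕ, ∀ n : ℕ, n₀ ≤ n →
      Real.exp (-(a * (dq n : ℝ))) < K / (2 * (n : ℝ) * ((n : ℝ) - 1)) := by
  -- threshold on `d = dq n`: `d > 512·9!/(K a⁹)` and `d ≥ 2`
  obtain ⟨d₁, hd₁⟩ := exists_nat_gt (512 * (Nat.factorial 9 : ℝ) / (K * a ^ 9))
  set d₀ : ℕ := max d₁ 2 with hd₀
  refine ⟨d₀ ^ 4, fun n hn => ?_⟩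
  have hd₀d : d₀ ≤ dq n := le_dq_of_pow_four_le hn
  set d : ℕ := dq n with hd
  have hd2 : (2 : ℝ) ≤ d := by exact_mod_cast le_trans (le_max_right d₁ 2) hd₀d
  have hdC : 512 * (Nat.factorial 9 : ℝ) / (K * a ^ 9) < d :=
    lt_of_lt_of_le hd₁ (by exact_mod_cast le_trans (le_max_left d₁ 2) hd₀d)
  -- `n ≥ 16`, so `2n(n−1) > 0`
  have hn16 : 16 ≤ n := le_trans (by
    calc (16 : ℕ) = 2 ^ 4 := by norm_num
      _ ≤ d₀ ^ 4 := Nat.pow_le_pow_left (le_max_right d₁ 2) 4) hn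
  have hnR : (16 : ℝ) ≤ n := by exact_mod_cast hn16
  have hpos : (0 : ℝ) < 2 * (n : ℝ) * ((n : ℝ) - 1) := by nlinarith
  -- `2n(n−1) < 512 d⁸`
  have hnd : (n : ℝ) < ((d : ℝ) + 1) ^ 4 := by
    have := lt_dq_add_one_pow_four n
    rw [← hd] at this
    exact_mod_cast this
  have hd1 : (d : ℝ) + 1 ≤ 2 * d := by linarith
  have hstep1 : 2 * (n : ℝ) * ((n : ℝ) - 1) < 512 * (d : ℝ) ^ 8 := by
    have hn0 : (0 : ℝ) ≤ n := by positivity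
    have e1 : 2 * (n : ℝ) * ((n : ℝ) - 1) < 2 * (((d : ℝ) + 1) ^ 4) ^ 2 := by nlinarith
    have e2 : (((d : ℝ) + 1) ^ 4) ^ 2 = ((d : ℝ) + 1) ^ 8 := by ring
    have e3 : ((d : ℝ) + 1) ^ 8 ≤ (2 * (d : ℝ)) ^ 8 :=
      pow_le_pow_left₀ (by positivity) hd1 8
    have e4 : (2 * (d : ℝ)) ^ 8 = 256 * (d : ℝ) ^ 8 := by ring
    nlinarith
  -- `512 d⁸ < K e^{a d}`
  have hstep2 : 512 * (d : ℝ) ^ 8 < K * Real.exp (a * d) := by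
    have had : (0 : ℝ) ≤ a * d := by positivity
    have hexp : (a * d) ^ 9 / (Nat.factorial 9 : ℝ) ≤ Real.exp (a * d) :=
      Real.pow_div_factorial_le_exp (a * d) had 9
    have hfac : (0 : ℝ) < (Nat.factorial 9 : ℝ) := by positivity
    have hKa : (0 : ℝ) < K * a ^ 9 := by positivity
    -- from `512·9!/(K a⁹) < d`: `512·9! < K a⁹ d`
    have hmain : 512 * (Nat.factorial 9 : ℝ) < K * a ^ 9 * d := by
      have := (div_lt_iff₀ hKa).1 hdC
      linarith
    have hd8 : (0 : ℝ) < (d : ℝ) ^ 8 := by positivity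
    calc 512 * (d : ℝ) ^ 8 = (512 * (Nat.factorial 9 : ℝ)) * (d : ℝ) ^ 8 / (Nat.factorial 9 : ℝ) := by
          field_simp
      _ < (K * a ^ 9 * d) * (d : ℝ) ^ 8 / (Nat.factorial 9 : ℝ) := by
          exact div_lt_div_of_pos_right (mul_lt_mul_of_pos_right hmain hd8) hfac
      _ = K * ((a * d) ^ 9 / (Nat.factorial 9 : ℝ)) := by ring
      _ ≤ K * Real.exp (a * d) := mul_le_mul_of_nonneg_left hexp hK.le
  have hlt : 2 * (n : ℝ) * ((n : ℝ) - 1) < K * Real.exp (a * d) := lt_trans hstep1 hstep2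
  rw [Real.exp_neg, lt_div_iff₀ hpos]
  have hexp0 : (0 : ℝ) < Real.exp (a * (d : ℝ)) := Real.exp_pos _
  calc (Real.exp (a * (d : ℝ)))⁻¹ * (2 * (n : ℝ) * ((n : ℝ) - 1))
      < (Real.exp (a * (d : ℝ)))⁻¹ * (K * Real.exp (a * d)) :=
        mul_lt_mul_of_pos_left hlt (inv_pos.2 hexp0)
    _ = K := by field_simp

/-- **BARRIER at the crux's scale.** For every `K, a > 0` there is `n₀` such that for all `n ≥ n₀` and every exact
design of degree `≥ 1` on cuts of `K_n`, NO two-sided transfer certificate with constant `K` certifies the crux's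
bound `e^{−a·dq n}` for its planted weight (hence, by `IsTwoSidedTransferCertificate.mono`, none certifies any
smaller bound such as `n^{−a·dq n}`). [cite: AlonNaor2006, §1 and Lemma 3.1 (eq. (4))] [cite: Rothvoss2017, §2 (PDF p. 6, eq. (2))] -/
theorem not_twoSidedTransferCertificate_exp {K a : ℝ} (hK : 0 < K) (ha : 0 < a) :
    ∃ n₀ : ℕ, ∀ n : ℕ, n₀ ≤ n → ∀ (t T D : ℕ) (B : ℝ) (C : Finset ℕ) (w : ℕ → ℝ),
      IsExactDesign n t T D B C w → 1 ≤ D →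
        ¬IsTwoSidedTransferCertificate K (Real.exp (-(a * (dq n : ℝ)))) (levelWeight n t C w) := by
  obtain ⟨n₀, h₀⟩ := exp_neg_dq_lt_eventually hK ha
  refine ⟨n₀, fun n hn t T D B C w hdes hD hcert => ?_⟩
  have h1 := twoSidedTransferCertificate_ge hdes hD hK.le hcert
  exact absurd (lt_of_le_of_lt h1 (h₀ n hn)) (lt_irrefl _)

end Literature.Barriers.PneNP

end
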